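import Mathlib
import Summits.Ventures.PercRepro2.FMDecompAll
import Summits.Ventures.PercRepro2.ReachBits
import Summits.Ventures.PercRepro2.MixedBoxDefs
import Summits.Ventures.PercRepro2.CellMonoRefutation

/-!
# The UU inequality is FALSE: a kernel-checked refutation of `UU_all`
(blind cell PercRepro2, night-1 g34; proofs/NIGHT1-G34.md §1)

`FMDecompAll.UUIneq p ends o a₁ a₂ x` is `D_o · P(Q) ≤ P(Q, o ∈ U) · P(PD_x)` with `Q = {a₁ ↮ a₂}`,
`U = C(a₁) ∪ C(a₂)`, `PD_x = Q ∩ {x ∉ U}`, `D_o = P(PD_x, o ∈ U)` — equivalently the positive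
association `P(Q, o ∈ U, x ∈ U) · P(Q) ≥ P(Q, o ∈ U) · P(Q, x ∈ U)` of `U_o` and `U_x` on `Q`
(night-1 g33 §10: census-true on 13,316 random instances with `n = 7 … 11`).  It is false.

THE WITNESS — the bowtie: five vertices `a₁ = 0`, `a₂ = 1`, the core `A = 2`, `x = 3`, `o = 4`; six
edges `0–2`, `1–2` (weight `9/10` each), `0–3` (`8/10`), `3–2` (`3/10`), `1–4` (`8/10`), `4–2`
(`3/10`): two triangles `(a₁, x, A)` and `(a₂, o, A)` glued at `A`.  With the integer weight
`wt ω = ∏_e (num_e if e open else 10 − num_e)` (`D = 10⁶`), the six masses are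

  `m(Q) = 146224`, `m(Q, a₁ ↔ o) = 5544`, `m(Q, a₂ ↔ o) = 116648`,
  `m(PD_x) = 24032`, `m(PD_x, a₁ ↔ o) = 756`, `m(PD_x, a₂ ↔ o) = 19348`,

so `D_o · P(Q) = 20104 · 146224 = 2939687296 > 2936518144 = 122192 · 24032 = P(Q, o ∈ U) · P(PD_x)`
(in units of `10⁻¹²`): `Cov_Q(U_o, U_x) = −3169152 / 146224² < 0`, `γ = D_o/D = 2513/3004 > γ₀ =
7637/9139`.  Mechanism: `Q` is realised by one of two cuts — `a₁` severed from the core (then `o ∈ U`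
is likely while `x ∈ U` needs exactly one of its two edges) or `a₂` severed (the mirror) — a mixture
in which the conditional means of `U_o` and `U_x` move in opposite directions (within each cut they
are independent).  Consequences: `UU_all ℚ` is false, so the second hypothesis of the night-1 g33
reduction `HCov_all_of_a3Between_UU` cannot be discharged; the decomposition
`FMfun = btw + (γ₀ − γ)·BR` (FMDecomp) and the g32 reduction through (MEANS-a₃) ∧ (FM) stand, and on
this very instance (MEANS-a₃), (FM) and (HCOV) all hold (cell census, three own codes).

The masses are decided by the kernel with the bitmask reachability of `ReachBits.decConnB`
(`decide +kernel`, as in `CellMonoRefutation`); standard axioms; one seat.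
-/

namespace Summit.Ventures.PercRepro2

namespace UURefutation

open UnionCluster CovForm

/-- The six edges of the bowtie on the vertices `0..4`: `0–2, 1–2, 0–3, 3–2, 1–4, 4–2`. -/
def ends : Fin 6 → Sym2 (Fin 5) := ![s(0, 2), s(1, 2), s(0, 3), s(3, 2), s(1, 4), s(4, 2)]

/-- The numerators of the edge weights (denominator `10`). -/
def num : Fin 6 → ℕ := ![9, 9, 8, 3, 8, 3]

/-- The edge weights `num e / 10`. -/
def p : Fin 6 → ℚ := fun e => (num e : ℚ) / 10

/-- The integer weight of a configuration: `∏_e (num e if e open else 10 − num e)`. -/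
def wt : Config (Fin 6) → ℕ := fun ω => ∏ e, (if ω e then num e else 10 - num e)

/-- Every numerator is at most `10`. -/
lemma num_le (e : Fin 6) : num e ≤ 10 := by fin_cases e <;> decide

/-- The weights are admissible. -/
lemma p_isProbVec : IsProbVec p :=
  ⟨fun e => by unfold p; positivity,
   fun e => by
    unfold p
    have h : (num e : ℚ) ≤ 10 := by exact_mod_cast num_le e
    linarith [div_le_one_of_le₀ h (by norm_num : (0 : ℚ) ≤ 10)]⟩

/-- One Bernoulli factor as an integer numerator over `10`. -/
lemma edgeFactor_eq (e : Fin 6) (b : Bool) :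
    edgeFactor (p e) b = ((if b then num e else 10 - num e : ℕ) : ℚ) / 10 := by
  cases b
  · have h : num e ≤ 10 := num_le e
    simp only [edgeFactor_false, p, Bool.false_eq_true, ↓reduceIte]
    rw [Nat.cast_sub h]
    push_cast
    ring
  · simp [edgeFactor_true, p]

/-- `weight p ω = wt ω / 10⁶`. -/
lemma weight_eq (ω : Config (Fin 6)) : weight p ω = (wt ω : ℚ) / 10 ^ 6 := by
  unfold weight wt
  simp only [edgeFactor_eq]
  rw [Finset.prod_div_distrib, Finset.prod_const, Finset.card_univ, Fintype.card_fin, Nat.cast_prod]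

/-- The bitmask decision of `Conn` on the bowtie (`ReachBits.decConnB`), installed as the instance
used by the kernel computations below. -/
instance instDecConnFast (ω : Config (Fin 6)) : DecidableRel (Conn ends ω) := fun u v =>
  decConnB ends ω u v

/-- Membership in a connection event is decidable (fast). -/
instance instDecConnEvent (u v : Fin 5) : DecidablePred (· ∈ connEvent ends u v) := fun ω =>
  inferInstanceAs (Decidable (Conn ends ω u v))

/-- Membership in `Q = avoidAll ends 1 {0}` is decidable (fast). -/
instance instDecQ : DecidablePred (· ∈ avoidAll ends 1 {0}) := fun ω =>
  inferInstanceAs (Decidable (∀ x ∈ ({0} : Finset (Fin 5)), ¬ Conn ends ω 1 x))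

/-- Membership in `Ũ_x = {x ∈ C(a₁) ∪ C(a₂)}` is decidable (fast). -/
instance instDecInU (a₁ a₂ x : Fin 5) : DecidablePred (· ∈ inU ends a₁ a₂ x) := fun ω =>
  inferInstanceAs (Decidable (ω ∈ connEvent ends x a₁ ∪ connEvent ends x a₂))

/-- Membership in `PD_x` is decidable (fast). -/
instance instDecPD (a₁ a₂ x : Fin 5) : DecidablePred (· ∈ PDEvent ends a₁ a₂ x) := fun ω =>
  inferInstanceAs (Decidable (ω ∈ (connEvent ends a₁ a₂)ᶜ ∩ (inU ends a₁ a₂ x)ᶜ))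

set_option maxRecDepth 100000 in
set_option maxHeartbeats 4000000 in
/-- `m(Q) = 146224`. -/
theorem mass_Q : MixedBox.mass wt (avoidAll ends 1 {0}) = 146224 := by
  rw [CellMonoRefutation.mass_eq_sum6]
  decide +kernel

set_option maxRecDepth 100000 in
set_option maxHeartbeats 4000000 in
/-- `m(Q, a₁ ↔ o) = 5544`. -/
theorem mass_Qo1 : MixedBox.mass wt (avoidAll ends 1 {0} ∩ connEvent ends 0 4) = 5544 := by
  rw [CellMonoRefutation.mass_eq_sum6]
  decide +kernel

set_option maxRecDepth 100000 in
set_option maxHeartbeats 4000000 in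
/-- `m(Q, a₂ ↔ o) = 116648`. -/
theorem mass_Qo2 : MixedBox.mass wt (avoidAll ends 1 {0} ∩ connEvent ends 1 4) = 116648 := by
  rw [CellMonoRefutation.mass_eq_sum6]
  decide +kernel

set_option maxRecDepth 100000 in
set_option maxHeartbeats 4000000 in
/-- `m(PD_x) = 24032`. -/
theorem mass_PD : MixedBox.mass wt (PDEvent ends 0 1 3) = 24032 := by
  rw [CellMonoRefutation.mass_eq_sum6]
  decide +kernel

set_option maxRecDepth 100000 in
set_option maxHeartbeats 4000000 in
/-- `m(PD_x, a₁ ↔ o) = 756`. -/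
theorem mass_PDo1 : MixedBox.mass wt (PDEvent ends 0 1 3 ∩ connEvent ends 0 4) = 756 := by
  rw [CellMonoRefutation.mass_eq_sum6]
  decide +kernel

set_option maxRecDepth 100000 in
set_option maxHeartbeats 4000000 in
/-- `m(PD_x, a₂ ↔ o) = 19348`. -/
theorem mass_PDo2 : MixedBox.mass wt (PDEvent ends 0 1 3 ∩ connEvent ends 1 4) = 19348 := by
  rw [CellMonoRefutation.mass_eq_sum6]
  decide +kernel

/-- **The UU inequality fails on the bowtie** at `(o, a₁, a₂, x) = (4, 0, 1, 3)`:
`D_o · P(Q) = 2939687296 · 10⁻¹² > 2936518144 · 10⁻¹² = P(Q, o ∈ U) · P(PD_x)`. -/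
theorem not_UUIneq : ¬ A3Fibre.FMDecomp.UUIneq ℚ p ends 4 0 1 3 := by
  unfold A3Fibre.FMDecomp.UUIneq Do LeafStep.mU
  rw [MixedBox.prob_eq_mass_div weight_eq, MixedBox.prob_eq_mass_div weight_eq,
    MixedBox.prob_eq_mass_div weight_eq, MixedBox.prob_eq_mass_div weight_eq,
    MixedBox.prob_eq_mass_div weight_eq, MixedBox.prob_eq_mass_div weight_eq,
    mass_Q, mass_Qo1, mass_Qo2, mass_PD, mass_PDo1, mass_PDo2]
  norm_num

/-- **`UU_all ℚ` is false**: the UU inequality does not hold for every finite graph, every mark and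
every explored vertex — the bowtie is a counterexample. -/
theorem not_UU_all : ¬ A3Fibre.FMDecomp.UU_all ℚ := fun h =>
  not_UUIneq (h (Fin 5) (Fin 6) ends p p_isProbVec 4 0 1 3)

end UURefutation

end Summit.Ventures.PercRepro2
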